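import Summits.NavierStokesRegularity.FunctionalMining.TopEigMomentRateSup
import Summits.NavierStokesRegularity.FunctionalMining.StrainMomentProduction
import Literature.Analysis.FunctionSpaces.TorusSobolevL6
import HarnessLib

/-!
# FunctionalMining — the static production chain for the regularised `λ₁`-moment at the `T_LD` exponents

Search for candidate a priori estimates; no regularity claim. Cell `pub-nsfunc`, prove seat
(gen 17). Kernel support for Theorem G (ii) of SIEVELD §3.4 (`TopEigTLDOfCoercive`): the Lebesgue
chain of SIEVELD §3.3 ("the production bound of §3.3 verbatim, `|S| ≤ √6 λ₁`") for the regularised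
density `ρ = g̃_φ(S) = (φ̃ ⋆ g + 2r)(S)` of an admissible `g` (`|S| ≤ 6 g(S) ≤ 6ρ`), with the ONE
difference that makes Lemma L-λ necessary: the top Lebesgue node is the INHOMOGENEOUS Sobolev
inequality for `w = ρ^{q/2}` (no mean-zero structure for the spectral weight),

`∫ ρ^{3q} = ‖w‖₆⁶ ≤ C_S (‖w‖₂² + ‖∇w‖₂²)³ = C_S (F + X)³`,  `F = ∫ρ^q`, `X = ∫|∇w|²`,

so that the production is bounded by `J^a (Z_ρ F^{1+1/σ})^{1−a}` with `J = X + F` (not `X` alone),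
`a = (3q−3)/(5q−6)`, `σ = 2q−3`, `Z_ρ = ∫ρ²`:

* `TopEig.exists_integral_pow_six_le_inhom` — `∫|w|⁶ ≤ C(∫|w|² + ∫∑ₖ|∂ₖw|²)³` on `T³` (tree
  `Torus.lintegral_enorm_pow_six_le_cube_of_isSmooth`, real form);
* `TopEig.production_rpow_bookkeeping_two_le` — SIEVELD §3.2 exponent bookkeeping for every real
  `q ≥ 2` (the tree's `VorticityMoment.production_rpow_bookkeeping` is `q > 2`; `q = 2` by hand);
* `TopEig.lebesgue_chain` — for a continuous `b ≥ 0` with `∫b^q ≤ L∫(∑ₖ‖∂ₖv‖²)^q`: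
  `∫ ρ^{q−1} b ≤ √2 (L K 6^{2q})^{1/q} C_S^{a/3} J^a (Z_ρ F^{1+1/σ})^{1−a}` (Hölder, strain
  Calderón–Zygmund at `s = 2q`, coercivity, Cauchy–Schwarz, the top node, outward interpolation).

[ours; N8/§3.3 chain with tree inputs]
-/

noncomputable section

open MeasureTheory Set Filter Topology Finset
open scoped InnerProductSpace RealInnerProductSpace ContDiff NNReal ENNReal

namespace Summit.NavierStokesRegularity.FunctionalMining

open Literature.Analysis.FunctionSpaces Literature.Analysis.FunctionSpaces.Torus
  Literature.Analysis.FluidPDE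

namespace TopEig

open StrainL4 StrainMoment VorticityL4

/-! ## 1. The inhomogeneous Sobolev inequality, real scalar form -/

section Sobolev

variable {d : Type*} [Fintype d] [DecidableEq d]

/-- **Inhomogeneous Sobolev embedding on `T³`, real scalar form**: there is `C ≥ 0` with
`∫ |w|⁶ ≤ C (∫ |w|² + ∫ ∑ₖ |∂ₖw|²)³` for every smooth `w : T³ → ℝ` (no mean-zero hypothesis).
[folklore; tree `Torus.lintegral_enorm_pow_six_le_cube_of_isSmooth`] -/
theorem exists_integral_pow_six_le_inhom (hd : Fintype.card d = 3) :
    ∃ C : ℝ, 0 ≤ C ∧ ∀ w : UnitAddTorus d → ℝ, IsSmooth w →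
      ∫ x, ‖w x‖ ^ 6 ≤ C * ((∫ x, ‖w x‖ ^ 2) + ∫ x, ∑ k, ‖Torus.partialDeriv k w x‖ ^ 2) ^ 3 := by
  obtain ⟨K, hK⟩ := Torus.lintegral_enorm_pow_six_le_cube_of_isSmooth (F' := ℝ) hd
  have hK0 : (0 : ℝ) ≤ K := NNReal.coe_nonneg K
  refine ⟨(K : ℝ) * (Fintype.card d : ℝ) ^ 3, by positivity, fun w hws => ?_⟩
  have hwc : Continuous w := hws.continuous
  have hDc : Continuous (Torus.fderiv w) := Torus.continuous_fderiv_of_isSmooth hws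
  set G : ℝ := ∫ x, ∑ k, ‖Torus.partialDeriv k w x‖ ^ 2 with hG
  have hG0 : 0 ≤ G := integral_nonneg fun x => Finset.sum_nonneg fun k _ => sq_nonneg _
  have h6 := hK w hws
  have conv : ∀ {f : UnitAddTorus d → ℝ} (_ : Continuous f) (_ : ∀ x, 0 ≤ f x) (k : ℕ),
      ∫⁻ x, (ENNReal.ofReal (f x)) ^ k = ENNReal.ofReal (∫ x, f x ^ k) := by
    intro f hf hf0 k
    have hi : Integrable (fun x => f x ^ k) volume := (hf.pow k).integrable_unitAddTorus
    rw [ofReal_integral_eq_lintegral_ofReal hi (ae_of_all _ fun x => pow_nonneg (hf0 x) k)]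
    exact lintegral_congr fun x => (ENNReal.ofReal_pow (hf0 x) k).symm
  have e6 : ∫⁻ x, ‖w x‖ₑ ^ 6 = ENNReal.ofReal (∫ x, ‖w x‖ ^ 6) := by
    rw [← conv hwc.norm (fun x => norm_nonneg _) 6]
    exact lintegral_congr fun x => by rw [ofReal_norm]
  have e2 : ∫⁻ x, ‖w x‖ₑ ^ 2 = ENNReal.ofReal (∫ x, ‖w x‖ ^ 2) := by
    rw [← conv hwc.norm (fun x => norm_nonneg _) 2]
    exact lintegral_congr fun x => by rw [ofReal_norm]
  have eD : ∫⁻ x, ‖Torus.fderiv w x‖ₑ ^ 2 = ENNReal.ofReal (∫ x, ‖Torus.fderiv w x‖ ^ 2) := by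
    rw [← conv hDc.norm (fun x => norm_nonneg _) 2]
    exact lintegral_congr fun x => by rw [ofReal_norm]
  have hA0 : 0 ≤ ∫ x, ‖w x‖ ^ 2 := integral_nonneg fun x => sq_nonneg _
  have hB0 : 0 ≤ ∫ x, ‖Torus.fderiv w x‖ ^ 2 := integral_nonneg fun x => sq_nonneg _
  rw [e6, e2, eD, ← ENNReal.ofReal_add hA0 hB0, ← ENNReal.ofReal_pow (by positivity),
    ← ENNReal.ofReal_coe_nnreal, ← ENNReal.ofReal_mul hK0] at h6
  have h6' : ∫ x, ‖w x‖ ^ 6 ≤ K * ((∫ x, ‖w x‖ ^ 2) + ∫ x, ‖Torus.fderiv w x‖ ^ 2) ^ 3 :=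
    (ENNReal.ofReal_le_ofReal_iff (by positivity)).1 h6
  have hDw : ∫ x, ‖Torus.fderiv w x‖ ^ 2 ≤ Fintype.card d * G :=
    CodomainSobolev.integral_norm_fderiv_sq_le_card_mul hws
  have hd1 : (1 : ℝ) ≤ Fintype.card d := by rw [hd]; norm_num
  have hsum : (∫ x, ‖w x‖ ^ 2) + ∫ x, ‖Torus.fderiv w x‖ ^ 2 ≤
      Fintype.card d * ((∫ x, ‖w x‖ ^ 2) + G) := by nlinarith
  have hS0 : 0 ≤ (∫ x, ‖w x‖ ^ 2) + ∫ x, ‖Torus.fderiv w x‖ ^ 2 := add_nonneg hA0 hB0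
  calc ∫ x, ‖w x‖ ^ 6 ≤ K * ((∫ x, ‖w x‖ ^ 2) + ∫ x, ‖Torus.fderiv w x‖ ^ 2) ^ 3 := h6'
    _ ≤ K * (Fintype.card d * ((∫ x, ‖w x‖ ^ 2) + G)) ^ 3 := by gcongr
    _ = K * (Fintype.card d : ℝ) ^ 3 * ((∫ x, ‖w x‖ ^ 2) + G) ^ 3 := by ring

end Sobolev

/-! ## 2. Powers of the regularised weight -/

section Powers

variable {ι : Type*} [Fintype ι] (φ : ContDiffBump (0 : EuclideanSpace ℝ ι))
  {g : EuclideanSpace ℝ ι → ℝ}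

/-- `(g̃^{q/2})² = g̃^q` on `U_φ`. [ours] -/
theorem weight_half_sq (q : ℝ) {z : EuclideanSpace ℝ ι} (hz : z ∈ posSet φ g) :
    weight φ g (q / 2) z ^ 2 = weight φ g q z := by
  unfold weight
  rw [← Real.rpow_natCast, ← Real.rpow_mul (le_of_lt hz)]
  congr 1; push_cast; ring

/-- `(g̃^{q/2})⁶ = g̃^{3q}` on `U_φ`. [ours] -/
theorem weight_half_pow_six (q : ℝ) {z : EuclideanSpace ℝ ι} (hz : z ∈ posSet φ g) :
    weight φ g (q / 2) z ^ 6 = lamReg φ g z ^ (3 * q) := by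
  unfold weight
  rw [← Real.rpow_natCast, ← Real.rpow_mul (le_of_lt hz)]
  congr 1; push_cast; ring

/-- `W_φ^{q/2} ∘ Θ` is smooth for a smooth `Θ` with values in `U_φ` (`g` continuous). [ours] -/
theorem isSmooth_weight_comp {d : Type*} [Fintype d] (hgc : Continuous g) (q : ℝ)
    {Θ : UnitAddTorus d → EuclideanSpace ℝ ι} (hΘ : IsSmooth Θ) (hmaps : ∀ y, Θ y ∈ posSet φ g) :
    IsSmooth (fun y => weight φ g q (Θ y)) := by
  unfold IsSmooth
  exact (contDiffOn_weight φ hgc q (n := ∞) le_rfl).comp_contDiff hΘ fun y => hmaps _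

end Powers

/-! ## 3. Exponent bookkeeping for every real `q ≥ 2` -/

/-- **Exponent bookkeeping of SIEVELD §3.2 at every real `q ≥ 2`.** For non-negative reals with
`X ≤ √2 F^{(q−1)/q} G^{1/q}`, `G ≤ K A₂`, `A₂² ≤ F A`, `A ≤ T`, `F ≤ Z^θ A^{1−θ}`
(`θ = 2q/(3q−2)`): `X ≤ √2 K^{1/q} T^{a/3} (Z F^{1+1/(2q−3)})^{1−a}`, `a = (3q−3)/(5q−6)` (the tree's
`VorticityMoment.production_rpow_bookkeeping` for `q > 2`; at `q = 2`: `a = 3/4` and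
`X ≤ √2 (KA₂)^{1/2} F^{1/2} ≤ √2 K^{1/2} (FT)^{1/4} F^{1/2} ≤ √2 K^{1/2} T^{1/4} (Z F²)^{1/4}`).
[ours; elementary] -/
theorem production_rpow_bookkeeping_two_le {q X F G A₂ A T Z K : ℝ} (hq : 2 ≤ q) (hF : 0 ≤ F)
    (hG : 0 ≤ G) (hA₂ : 0 ≤ A₂) (hA : 0 ≤ A) (hZ : 0 ≤ Z) (hK : 0 ≤ K)
    (h1 : X ≤ Real.sqrt 2 * (F ^ ((q - 1) / q) * G ^ (1 / q))) (h2 : G ≤ K * A₂)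
    (h3 : A₂ ^ 2 ≤ F * A) (h4 : A ≤ T)
    (h5 : F ≤ Z ^ (2 * q / (3 * q - 2)) * A ^ (1 - 2 * q / (3 * q - 2))) :
    X ≤ Real.sqrt 2 * K ^ (1 / q) * T ^ ((3 * q - 3) / (5 * q - 6) / 3) *
      (Z * F ^ (1 + (2 * q - 3)⁻¹)) ^ (1 - (3 * q - 3) / (5 * q - 6)) := by
  rcases eq_or_lt_of_le hq with rfl | hq'
  · -- `q = 2`
    have hT : 0 ≤ T := hA.trans h4
    norm_num at h1 h5 ⊢
    -- `h5 : F ≤ Z`, goal: `X ≤ √2 K^{1/2} T^{1/4} (Z F²)^{1/4}`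
    have s1 : G ^ (1 / 2 : ℝ) ≤ K ^ (1 / 2 : ℝ) * A₂ ^ (1 / 2 : ℝ) := by
      rw [← Real.mul_rpow hK hA₂]; exact Real.rpow_le_rpow hG h2 (by norm_num)
    have s2 : A₂ ^ (1 / 2 : ℝ) ≤ F ^ (1 / 4 : ℝ) * T ^ (1 / 4 : ℝ) := by
      have h3' : A₂ ^ 2 ≤ F * T := h3.trans (mul_le_mul_of_nonneg_left h4 hF)
      have e : (A₂ ^ 2) ^ (1 / 4 : ℝ) = A₂ ^ (1 / 2 : ℝ) := by
        rw [← Real.rpow_natCast, ← Real.rpow_mul hA₂]; norm_num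
      rw [← e, ← Real.mul_rpow hF hT]
      exact Real.rpow_le_rpow (sq_nonneg _) h3' (by norm_num)
    have s3 : F ^ (1 / 4 : ℝ) ≤ Z ^ (1 / 4 : ℝ) := Real.rpow_le_rpow hF h5 (by norm_num)
    have e4 : (Z * F ^ 2) ^ (1 / 4 : ℝ) = Z ^ (1 / 4 : ℝ) * F ^ (1 / 2 : ℝ) := by
      rw [Real.mul_rpow hZ (sq_nonneg F), ← Real.rpow_natCast, ← Real.rpow_mul hF]; norm_num
    have hF2 : 0 ≤ F ^ (1 / 2 : ℝ) := Real.rpow_nonneg hF _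
    have hF4 : 0 ≤ F ^ (1 / 4 : ℝ) := Real.rpow_nonneg hF _
    have hK2 : 0 ≤ K ^ (1 / 2 : ℝ) := Real.rpow_nonneg hK _
    have hT4 : 0 ≤ T ^ (1 / 4 : ℝ) := Real.rpow_nonneg hT _
    have hZ4 : 0 ≤ Z ^ (1 / 4 : ℝ) := Real.rpow_nonneg hZ _
    rw [e4]
    calc X ≤ Real.sqrt 2 * (F ^ (1 / 2 : ℝ) * G ^ (1 / 2 : ℝ)) := h1
      _ ≤ Real.sqrt 2 * (F ^ (1 / 2 : ℝ) * (K ^ (1 / 2 : ℝ) * (F ^ (1 / 4 : ℝ) * T ^ (1 / 4 : ℝ)))) := by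
          gcongr
          exact s1.trans (mul_le_mul_of_nonneg_left s2 hK2)
      _ = Real.sqrt 2 * K ^ (1 / 2 : ℝ) * T ^ (1 / 4 : ℝ) * (F ^ (1 / 4 : ℝ) * F ^ (1 / 2 : ℝ)) := by
          ring
      _ ≤ Real.sqrt 2 * K ^ (1 / 2 : ℝ) * T ^ (1 / 4 : ℝ) * (Z ^ (1 / 4 : ℝ) * F ^ (1 / 2 : ℝ)) := by
          gcongr
  · exact VorticityMoment.production_rpow_bookkeeping hq' hF hG hA₂ hA hZ hK h1 h2 h3 h4 h5

/-! ## 4. The Lebesgue chain for the regularised density -/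

/-- Outward interpolation at every real `q ≥ 2` for a continuous non-negative `ρ`:
`∫ρ^q ≤ (∫ρ²)^θ (∫ρ^{3q})^{1−θ}`, `θ = 2q/(3q−2)` (`q = 2`: equality). [folklore] -/
theorem moment_q_le_interp_two_le {d : Type*} [Fintype d] {ρ : UnitAddTorus d → ℝ}
    (hρc : Continuous ρ) (hρ0 : ∀ y, 0 ≤ ρ y) {q : ℝ} (hq : 2 ≤ q) :
    ∫ x, ρ x ^ q ≤ (∫ x, ρ x ^ (2 : ℝ)) ^ (2 * q / (3 * q - 2)) *
      (∫ x, ρ x ^ (3 * q)) ^ (1 - 2 * q / (3 * q - 2)) := by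
  have hn : ∀ y, ‖ρ y‖ = ρ y := fun y => Real.norm_of_nonneg (hρ0 y)
  rcases eq_or_lt_of_le hq with rfl | hq'
  · norm_num
  · have h := moment_q_le_interp (w := ρ) hρc hq'
    simp only [hn] at h
    exact h

/-- **The Lebesgue chain for `ρ = g̃_φ(S_v)`** (module docstring): for real `q ≥ 2`, a Sobolev
constant `C_S` of `exists_integral_pow_six_le_inhom`, a strain Calderón–Zygmund bound at this field
(`∫(∑ₖ‖∂ₖv‖²)^q ≤ K∫|S|^{2q}`), a `1`-Lipschitz `g` with `g(S_v) ≥ 0` and `|S_v| ≤ 6g(S_v)`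
pointwise, and a continuous `b ≥ 0` with `∫b^q ≤ L∫(∑ₖ‖∂ₖv‖²)^q`:
`∫ρ^{q−1}b ≤ √2 (L K 6^{2q})^{1/q} C_S^{a/3} (X + F)^a (Z_ρ F^{1+1/(2q−3)})^{1−a}`, where
`F = ∫ρ^q`, `Z_ρ = ∫ρ²`, `X = ∫∑ₖ(∂ₖ(ρ^{q/2}))²`, `a = (3q−3)/(5q−6)`. [ours] -/
theorem lebesgue_chain {q : ℝ} (hq : 2 ≤ q) {CS K L : ℝ} (hCS : 0 ≤ CS) (hK : 0 ≤ K) (hL : 0 ≤ L)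
    (hSob : ∀ w : UnitAddTorus (Fin 3) → ℝ, IsSmooth w →
      ∫ x, ‖w x‖ ^ 6 ≤ CS * ((∫ x, ‖w x‖ ^ 2) + ∫ x, ∑ k, ‖Torus.partialDeriv k w x‖ ^ 2) ^ 3)
    (φ : ContDiffBump (0 : EuclideanSpace ℝ (Fin 3 × Fin 3)))
    {g : EuclideanSpace ℝ (Fin 3 × Fin 3) → ℝ} (hlip : LipschitzWith 1 g)
    {v : UnitAddTorus (Fin 3) → EuclideanSpace ℝ (Fin 3)} (hv : IsSmooth v)
    (hg0v : ∀ y, 0 ≤ g (strainFlat v y)) (hg6v : ∀ y, ‖strainFlat v y‖ ≤ 6 * g (strainFlat v y))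
    (hKv : ∫ x, (∑ k, ‖partialDeriv k v x‖ ^ 2) ^ q ≤ K * ∫ x, ‖strainFlat v x‖ ^ (2 * q))
    {b : UnitAddTorus (Fin 3) → ℝ} (hbc : Continuous b) (hb0 : ∀ y, 0 ≤ b y)
    (hbq : ∫ x, b x ^ q ≤ L * ∫ x, (∑ k, ‖partialDeriv k v x‖ ^ 2) ^ q) :
    ∫ y, lamReg φ g (strainFlat v y) ^ (q - 1) * b y ≤
      Real.sqrt 2 * (L * K * (6 : ℝ) ^ (2 * q)) ^ (1 / q) * CS ^ ((3 * q - 3) / (5 * q - 6) / 3) *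
        ((∫ y, ∑ k, (partialDeriv k (fun z => weight φ g (q / 2) (strainFlat v z)) y) ^ 2) +
          ∫ y, lamReg φ g (strainFlat v y) ^ q) ^ ((3 * q - 3) / (5 * q - 6)) *
        ((∫ y, lamReg φ g (strainFlat v y) ^ (2 : ℝ)) *
          (∫ y, lamReg φ g (strainFlat v y) ^ q) ^ (1 + (2 * q - 3)⁻¹)) ^
          (1 - (3 * q - 3) / (5 * q - 6)) := by
  have hq0 : 0 < q := by linarith
  have hq1 : 1 < q := by linarith
  have hgc : Continuous g := hlip.continuous
  have hS : IsSmooth (strainFlat v) := isSmooth_strainFlat hv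
  have hmaps : ∀ y, strainFlat v y ∈ posSet φ g := fun y => (mem_posSet_of_nonneg φ hlip (hg0v y)).1
  -- the density, its positivity and continuity
  set ρ : UnitAddTorus (Fin 3) → ℝ := fun y => lamReg φ g (strainFlat v y) with hρdef
  have hρpos : ∀ y, 0 < ρ y := fun y => hmaps y
  have hρ0 : ∀ y, 0 ≤ ρ y := fun y => (hρpos y).le
  have hρc : Continuous ρ := (contDiff_lamReg φ hgc).continuous.comp (continuous_strainFlat hv)
  have hn : ∀ y, ‖ρ y‖ = ρ y := fun y => Real.norm_of_nonneg (hρ0 y)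
  -- the function `w = ρ^{q/2}` and its smoothness
  set w : UnitAddTorus (Fin 3) → ℝ := fun y => weight φ g (q / 2) (strainFlat v y) with hwdef
  have hws : IsSmooth w := isSmooth_weight_comp φ hgc (q / 2) hS hmaps
  have hw0 : ∀ y, 0 ≤ w y := fun y => weight_nonneg φ (q / 2) (hmaps y)
  have hwn : ∀ y, ‖w y‖ = w y := fun y => Real.norm_of_nonneg (hw0 y)
  show ∫ y, ρ y ^ (q - 1) * b y ≤ Real.sqrt 2 * (L * K * (6 : ℝ) ^ (2 * q)) ^ (1 / q) *
      CS ^ ((3 * q - 3) / (5 * q - 6) / 3) *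
      ((∫ y, ∑ k, (partialDeriv k w y) ^ 2) + ∫ y, ρ y ^ q) ^ ((3 * q - 3) / (5 * q - 6)) *
      ((∫ y, ρ y ^ (2 : ℝ)) * (∫ y, ρ y ^ q) ^ (1 + (2 * q - 3)⁻¹)) ^ (1 - (3 * q - 3) / (5 * q - 6))
  -- the quantities
  have hg0' : ∀ x, 0 ≤ ∑ k, ‖partialDeriv k v x‖ ^ 2 := fun x =>
    Finset.sum_nonneg fun k _ => sq_nonneg _
  obtain ⟨F, hF⟩ : ∃ F : ℝ, F = ∫ y, ρ y ^ q := ⟨_, rfl⟩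
  obtain ⟨Gb, hGb⟩ : ∃ G : ℝ, G = ∫ y, b y ^ q := ⟨_, rfl⟩
  obtain ⟨G, hG⟩ : ∃ G : ℝ, G = ∫ x, (∑ k, ‖partialDeriv k v x‖ ^ 2) ^ q := ⟨_, rfl⟩
  obtain ⟨A₂, hA₂⟩ : ∃ A : ℝ, A = ∫ y, ρ y ^ (2 * q) := ⟨_, rfl⟩
  obtain ⟨A, hA⟩ : ∃ A : ℝ, A = ∫ y, ρ y ^ (3 * q) := ⟨_, rfl⟩
  obtain ⟨Z, hZ⟩ : ∃ Z : ℝ, Z = ∫ y, ρ y ^ (2 : ℝ) := ⟨_, rfl⟩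
  obtain ⟨X, hX⟩ : ∃ X : ℝ, X = ∫ y, ∑ k, (partialDeriv k w y) ^ 2 := ⟨_, rfl⟩
  have hF0 : 0 ≤ F := by rw [hF]; exact integral_nonneg fun y => Real.rpow_nonneg (hρ0 y) _
  have hGb0 : 0 ≤ Gb := by rw [hGb]; exact integral_nonneg fun y => Real.rpow_nonneg (hb0 y) _
  have hG0 : 0 ≤ G := by rw [hG]; exact integral_nonneg fun x => Real.rpow_nonneg (hg0' x) _
  have hA₂0 : 0 ≤ A₂ := by rw [hA₂]; exact integral_nonneg fun y => Real.rpow_nonneg (hρ0 y) _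
  have hA0 : 0 ≤ A := by rw [hA]; exact integral_nonneg fun y => Real.rpow_nonneg (hρ0 y) _
  have hZ0 : 0 ≤ Z := by rw [hZ]; exact integral_nonneg fun y => Real.rpow_nonneg (hρ0 y) _
  have hX0 : 0 ≤ X := by rw [hX]; exact integral_nonneg fun y => Finset.sum_nonneg fun k _ => sq_nonneg _
  rw [← hX, ← hF, ← hZ]
  -- h1: Hölder
  have h1 : ∫ y, ρ y ^ (q - 1) * b y ≤ Real.sqrt 2 * (F ^ ((q - 1) / q) * Gb ^ (1 / q)) := by
    have h := integral_rpow_mul_le_holder hρc hbc hρ0 hb0 hq1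
    rw [← hF, ← hGb] at h
    have hP0 : 0 ≤ F ^ ((q - 1) / q) * Gb ^ (1 / q) :=
      mul_nonneg (Real.rpow_nonneg hF0 _) (Real.rpow_nonneg hGb0 _)
    have h2 : (1 : ℝ) ≤ Real.sqrt 2 := Real.one_le_sqrt.2 (by norm_num)
    calc _ ≤ F ^ ((q - 1) / q) * Gb ^ (1 / q) := h
      _ = 1 * (F ^ ((q - 1) / q) * Gb ^ (1 / q)) := (one_mul _).symm
      _ ≤ Real.sqrt 2 * (F ^ ((q - 1) / q) * Gb ^ (1 / q)) := mul_le_mul_of_nonneg_right h2 hP0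
  -- h2: `∫b^q ≤ L G ≤ L K ∫|S|^{2q} ≤ L K 6^{2q} A₂`
  have hS2q : ∫ x, ‖strainFlat v x‖ ^ (2 * q) ≤ (6 : ℝ) ^ (2 * q) * A₂ := by
    rw [hA₂, ← integral_const_mul]
    refine integral_mono_of_nonneg (ae_of_all _ fun y => Real.rpow_nonneg (norm_nonneg _) _)
      ((hρc.rpow_const fun y => Or.inr (by linarith)).const_mul _ |>.integrable_unitAddTorus)
      (ae_of_all _ fun y => ?_)
    show ‖strainFlat v y‖ ^ (2 * q) ≤ (6 : ℝ) ^ (2 * q) * ρ y ^ (2 * q)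
    rw [← Real.mul_rpow (by norm_num) (hρ0 y)]
    exact Real.rpow_le_rpow (norm_nonneg _)
      (le_mul_lamReg_of_le_mul φ hlip (by norm_num) (hg6v y)) (by linarith)
  have h2 : Gb ≤ L * K * (6 : ℝ) ^ (2 * q) * A₂ := by
    calc Gb ≤ L * G := by rw [hGb, hG]; exact hbq
      _ ≤ L * (K * ((6 : ℝ) ^ (2 * q) * A₂)) := by
          refine mul_le_mul_of_nonneg_left ?_ hL
          rw [hG]
          exact hKv.trans (mul_le_mul_of_nonneg_left hS2q hK)
      _ = L * K * (6 : ℝ) ^ (2 * q) * A₂ := by ring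
  -- h3: Cauchy–Schwarz
  have h3 : A₂ ^ 2 ≤ F * A := by
    have h := moment_two_q_sq_le (w := ρ) hρc hq0
    simp only [hn] at h
    rw [hA₂, hF, hA]; exact h
  -- h4: the top node (inhomogeneous Sobolev for `w = ρ^{q/2}`)
  have h4 : A ≤ CS * (X + F) ^ 3 := by
    have h := hSob w hws
    have e6 : ∫ x, ‖w x‖ ^ 6 = A := by
      rw [hA]
      exact integral_congr_ae (ae_of_all _ fun y => by
        show ‖w y‖ ^ 6 = ρ y ^ (3 * q)
        rw [hwn y]; exact weight_half_pow_six φ q (hmaps y))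
    have e2 : ∫ x, ‖w x‖ ^ 2 = F := by
      rw [hF]
      exact integral_congr_ae (ae_of_all _ fun y => by
        show ‖w y‖ ^ 2 = ρ y ^ q
        rw [hwn y]; exact weight_half_sq φ q (hmaps y))
    have eX : ∫ x, ∑ k, ‖Torus.partialDeriv k w x‖ ^ 2 = X := by
      rw [hX]
      exact integral_congr_ae (ae_of_all _ fun y => Finset.sum_congr rfl fun k _ => by
        rw [Real.norm_eq_abs, sq_abs])
    rw [e6, e2, eX] at h
    calc A ≤ CS * (F + X) ^ 3 := h
      _ = CS * (X + F) ^ 3 := by rw [add_comm]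
  -- h5: outward interpolation
  have h5 : F ≤ Z ^ (2 * q / (3 * q - 2)) * A ^ (1 - 2 * q / (3 * q - 2)) := by
    rw [hF, hZ, hA]; exact moment_q_le_interp_two_le hρc hρ0 hq
  -- bookkeeping
  have hLK : 0 ≤ L * K * (6 : ℝ) ^ (2 * q) := by positivity
  have hbk := production_rpow_bookkeeping_two_le hq hF0 hGb0 hA₂0 hA0 hZ0 hLK h1 h2 h3 h4 h5
  have hXF : 0 ≤ X + F := add_nonneg hX0 hF0
  have hsplit : (CS * (X + F) ^ 3) ^ ((3 * q - 3) / (5 * q - 6) / 3) =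
      CS ^ ((3 * q - 3) / (5 * q - 6) / 3) * (X + F) ^ ((3 * q - 3) / (5 * q - 6)) := by
    rw [Real.mul_rpow hCS (pow_nonneg hXF 3), ← Real.rpow_natCast (X + F) 3, ← Real.rpow_mul hXF]
    congr 2
    push_cast
    ring
  rw [hsplit] at hbk
  calc ∫ y, ρ y ^ (q - 1) * b y
      ≤ Real.sqrt 2 * (L * K * (6 : ℝ) ^ (2 * q)) ^ (1 / q) *
          (CS ^ ((3 * q - 3) / (5 * q - 6) / 3) * (X + F) ^ ((3 * q - 3) / (5 * q - 6))) *
          (Z * F ^ (1 + (2 * q - 3)⁻¹)) ^ (1 - (3 * q - 3) / (5 * q - 6)) := hbk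
    _ = _ := by ring

end TopEig

end Summit.NavierStokesRegularity.FunctionalMining

end
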